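import Summits.AnomalousDissipation.AnomalousDissipation.Theorems.SolenoidalFractalHomogenisationLagrangianStepZ7GlueCompose
import Summits.AnomalousDissipation.AnomalousDissipation.Theorems.SolenoidalFractalHomogenisationLagrangianStepZ7GlueDefs
import HarnessLib

/-!
# K1L_D (stmt-AnomalousDissipation-27980): the αβ hypothesis of the §9z glue, RE-CUT — `cellInputs_alphaBeta_textR` (registered text of
# `stub_Z7_alphaBetaR`, (N1)/(N1*) GUARDED by weak solenoidality) and `cellInputs_alphaBeta_textP` (the PRE-PROJECTED form the glue consumes),
# with the bridges from the v2 text (Summits-side defs file; prover ad-sawtooth-k1loc-p1 g14 = pen of glue v3; tenure RULINGS D27-4 / D27-4′;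
# companion of `…Z7GlueDefs` (p694968, lead-k1l-onelevel-p1) — that file is untouched)

Finding F-p3g9-2 (prover ad-k1loc-p3 g9): the conjuncts (N1)/(N1*) of `Z7Glue.cellInputs_alphaBeta_text` — `∀ x : V2, lossFwd (Um (jR) s′) x ≤ CN·X2(x)`
— carry no solenoidal guard and are unprovable as typed (gradient witness `x = ∇cos(2πk′·z)`, `±k′ ∈ Sf`: `Um x = 0` by `eq_zero_of_orth`, so
`lossFwd = ‖x‖²` while `X2(x) = min(1, rate·τ)‖x‖²`).  Ruling D27-4 (R-a): the registered obligation is the natural statement on weakly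
divergence-free data; ruling D27-4′: the glue consumes the PRE-PROJECTED form, so that the glue core is landed once and bridges sit on both sides.

* `cellInputs_alphaBeta_textR` — `cellInputs_alphaBeta_text` VERBATIM except (N1)/(N1*) ↦ (N1′)/(N1*′):
  `∀ x : V2, Torus.IsWeaklyDivFree (⇑x : VF) → lossFwd (Um (jR) s′) x ≤ CN * X2(x)`, idem `lossAdj`/`y` — THE REGISTERED TEXT of `stub_Z7_alphaBetaR`;
* `cellInputs_alphaBeta_textP` — VERBATIM except (N1)/(N1*) ↦ (N1ᴾ)/(N1*ᴾ): `∀ x : V2, lossFwd (Um (jR) s′) (P_σ x) ≤ CN * X2(x)`, idem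
  `lossAdj (Um (jR) s′) (P_σ y) ≤ CN * Y2(y)`, `P_σ = (Torus.divFreeL2 (Fin 3)).starProjection` — what `Z7Glue.cellInputs_BIL_ofP` CONSUMES
  (for general `x, y` the glue pairs `(Um1 − Um)(P_σ x)` against `P_σ y`, so the losses it needs are exactly these);
* bridges: `alphaBeta_textR_of_text` (drop the guard: the v19–v22 stub `stub_Z7_alphaBeta` is SUPERSEDED-BY-WEAKER), `alphaBeta_textP_of_text`
  (monotonicity `lossFwd (Um a b) (P_σ x) ≤ lossFwd (Um a b) x`, `lossAdj (Um a b) (P_σ y) ≤ lossAdj (Um a b) y` for a propagator window map: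
  `Um ∘ P_σ = Um`, solenoidal range — `lossFwd_starProjection_le` / `lossAdj_starProjection_le`).  The bridge `textR → textP` (needs the Leray
  multiplier bound `X2 (P_σ x) ≤ X2 x`) is prover ad-k1loc-p3 g9's `…Z7GlueProj`.
Definitions + bridges only; nothing about (N1′), §9z, the crux or AD is proved here (rung F-D1.A0).
-/

set_option linter.dupNamespace false  -- the summit-side namespace `Summit.AnomalousDissipation.AnomalousDissipation.…` repeats a component by design (D-0017)

noncomputable section

namespace Summit.AnomalousDissipation.AnomalousDissipation.Theorems.SolenoidalFractalHomogenisation.LagrangianStep.Z7Glue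

open Literature.Analysis Literature.Analysis.FluidPDE Literature.Analysis.FunctionSpaces
open MeasureTheory Set Filter UnitAddTorus
open scoped ENNReal NNReal InnerProductSpace
open Literature.Analysis.FluidPDE.LatticeShear (LagrangianLatticeCarrier LatticeWord)
open Summit.AnomalousDissipation.AnomalousDissipation.Theorems.SolenoidalFractalHomogenisation.LagrangianStep.CellClauseMod

/-! ## §1 Loss monotonicity under the Leray projection for a propagator window map -/

/-- `q_{U a b}(P_σ x) ≤ q_{U a b}(x)`: a propagator window map sees only `P_σ x` and `‖P_σ x‖ ≤ ‖x‖`. [folklore] -/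
theorem lossFwd_starProjection_le {T₀ : ℝ} {b : ℝ → VF} {𝔸 : Torus.Visc4 (Fin 3)} {U : ℝ → ℝ → (V2 →L[ℝ] V2)}
    (hU : Torus.IsPropagator T₀ b 𝔸 U) (a t : ℝ) (x : V2) :
    lossFwd (U a t) ((Torus.divFreeL2 (Fin 3)).starProjection x) ≤ lossFwd (U a t) x := by
  unfold lossFwd
  rw [← hU.apply_eq_apply_starProjection a t x]
  have hn : ‖(Torus.divFreeL2 (Fin 3)).starProjection x‖ ≤ ‖x‖ := (Torus.divFreeL2 (Fin 3)).norm_starProjection_apply_le x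
  nlinarith [norm_nonneg ((Torus.divFreeL2 (Fin 3)).starProjection x), norm_nonneg x]

/-- `q*_{U a b}(P_σ y) ≤ q*_{U a b}(y)`: the adjoint of a map with solenoidal range sees only `P_σ y` (`adjoint_apply_eq_adjoint_starProjection`). [folklore] -/
theorem lossAdj_starProjection_le {T₀ : ℝ} {b : ℝ → VF} {𝔸 : Torus.Visc4 (Fin 3)} {U : ℝ → ℝ → (V2 →L[ℝ] V2)}
    (hU : Torus.IsPropagator T₀ b 𝔸 U) (a t : ℝ) (y : V2) :
    lossAdj (U a t) ((Torus.divFreeL2 (Fin 3)).starProjection y) ≤ lossAdj (U a t) y := by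
  unfold lossAdj
  rw [← adjoint_apply_eq_adjoint_starProjection (U a t) (fun x => hU.divFree a t x) y]
  have hn : ‖(Torus.divFreeL2 (Fin 3)).starProjection y‖ ≤ ‖y‖ := (Torus.divFreeL2 (Fin 3)).norm_starProjection_apply_le y
  nlinarith [norm_nonneg ((Torus.divFreeL2 (Fin 3)).starProjection y), norm_nonneg y]

/-- **The pairing sees only the solenoidal parts**: for two propagator window maps `⟪(U₁ − U) x, y⟫ = ⟪(U₁ − U)(P_σ x), P_σ y⟫`. [folklore] -/
theorem pairing_eq_pairing_starProjection {T₀ : ℝ} {b b₁ : ℝ → VF} {𝔸 𝔸₁ : Torus.Visc4 (Fin 3)} {U U₁ : ℝ → ℝ → (V2 →L[ℝ] V2)}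
    (hU : Torus.IsPropagator T₀ b 𝔸 U) (hU₁ : Torus.IsPropagator T₀ b₁ 𝔸₁ U₁) (a t : ℝ) (x y : V2) :
    ⟪U₁ a t x - U a t x, y⟫_ℝ
      = ⟪U₁ a t ((Torus.divFreeL2 (Fin 3)).starProjection x) - U a t ((Torus.divFreeL2 (Fin 3)).starProjection x),
          (Torus.divFreeL2 (Fin 3)).starProjection y⟫_ℝ := by
  set K := Torus.divFreeL2 (Fin 3) with hK
  have hmem : U₁ a t (K.starProjection x) - U a t (K.starProjection x) ∈ K :=
    K.sub_mem ((Torus.mem_divFreeL2_iff _).2 (hU₁.divFree a t _)) ((Torus.mem_divFreeL2_iff _).2 (hU.divFree a t _))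
  have horth : ⟪U₁ a t (K.starProjection x) - U a t (K.starProjection x), y - K.starProjection y⟫_ℝ = 0 :=
    K.inner_right_of_mem_orthogonal hmem (K.sub_starProjection_mem_orthogonal y)
  rw [hU₁.apply_eq_apply_starProjection a t x, hU.apply_eq_apply_starProjection a t x]
  have ey : y = K.starProjection y + (y - K.starProjection y) := by abel
  conv_lhs => rw [ey]
  rw [inner_add_right, horth, add_zero]

/-! ## §2 The two re-cut texts -/

/-- **The αβ hypothesis, RE-CUT (D27-4 R-a) — THE REGISTERED TEXT of `stub_Z7_alphaBetaR`.**  `cellInputs_alphaBeta_text` (p694968) VERBATIM except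
that the N-conversions (N1′)/(N1*′) are asked for WEAKLY DIVERGENCE-FREE data only. -/
def cellInputs_alphaBeta_textR : Prop :=
 ∀ k (W : Literature.Analysis.FluidPDE.LatticeShear.LatticeWord k) (M : ℝ) (hM : 0 < M) (c : ℝ), 0 < c →
    ∀ (Φ : ℝ → Torus.Visc4 (Fin 3) → Torus.Visc4 (Fin 3)) (lo hi Λ β σ C ν₀ K Cf νf Kf : ℝ),
      0 < lo → lo ≤ 1 → 1 ≤ hi → 1 < Λ → 0 ≤ β →
      0 < σ → 0 ≤ C → 0 < ν₀ → 0 < K → SlowVectorClauseF W M hM c Φ lo hi Λ β σ C ν₀ K →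
      0 ≤ Cf → 0 < νf → 0 < Kf → CellEnergyClausesW W M hM c lo hi Λ β Cf νf Kf →
      (∀ Kb : ℝ, 1 ≤ Kb → ∃ CK : ℝ, 1 ≤ CK ∧ ∃ cK > (0:ℝ), ∃ νh > (0:ℝ), HighLabelDecayW W M hM lo hi Λ β νh Kb CK cK) →
      ∃ ν₁ > (0:ℝ), ∃ K₁ > (0:ℝ), ∃ Λ₀ : ℕ, ∃ θ₀ > (0:ℝ), ∃ Cα > (0:ℝ), ∃ ϱ > (0:ℝ), ∃ CN > (0:ℝ), ∃ Cmono > (0:ℝ),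
        ∀ E : Literature.Analysis.FluidPDE.LatticeShear.LagrangianLatticeCarrier k, E.design = W.stretch M hM → E.gain = c → E.nu0 ≤ ν₁ → K₁ ≤ E.K →
          E.LPermissible → E.Regular → (∀ m, Λ₀ * E.N m ≤ E.N (m + 1)) → (∀ m, E.N m ^ 2 ≤ E.N (m + 1)) →
          (∀ m, E.cellVisc (m + 1) * ((E.N (m + 1) : ℝ) / E.N m) ^ (1 / 4 : ℝ) ≤ 1) →
          (∀ m, E.K * ((E.N (m + 1) : ℝ) / E.N m) ^ (1 / 4 : ℝ) ≤ ((E.N (m + 1) : ℝ) / E.N m) * E.cellVisc (m + 1)) →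
          (∀ m, E.θ (m + 1) * ((E.N (m + 1) : ℝ) / E.N m) ^ (1 / 16 : ℝ) ≤ θ₀) →
          (∀ m, ((E.N (m + 1) : ℝ) / E.N m) ^ (1 / 16 : ℝ) * E.physPeriod (m + 1) ≤ E.refresh (m + 1)) →
        ∃ mstar : ℕ, ∀ m, mstar ≤ m →
          ∀ Lc : ℕ, Lc = ⌊((E.N m : ℝ) / E.N (m + 1)) ^ (1 / 64 : ℝ) * (E.N (m + 1) * E.cellVisc (m + 1)) / Real.sqrt c⌋₊ →
          ∀ S : Torus.Visc4 (Fin 3), Torus.OddSmall S β → Torus.NearIso S lo hi →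
            Torus.OddSmall (Φ (E.cellVisc (m + 1)) S) β → Torus.NearIso (Φ (E.cellVisc (m + 1)) S) lo hi →
          ∀ Um Um1 : ℝ → ℝ → (V2 →L[ℝ] V2),
            Torus.IsPropagator 1 (E.partialSum m) (E.kbar m • renormStep (Φ (E.cellVisc (m + 1))) (E.gain / E.cellVisc (m + 1) ^ 2) S) Um →
            Torus.IsPropagator 1 (E.partialSum (m + 1)) (E.kbar (m + 1) • S) Um1 →
          ∀ Sf : Finset (Fin 3 → ℤ), Sf = (Torus.freqBall (Lc / 2)).erase 0 →
          ∀ (j : ℕ) (s' : ℝ), (j : ℝ) * E.refresh (m + 1) + E.refresh (m + 1) ≤ s' →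
            s' ≤ (j : ℝ) * E.refresh (m + 1) + 2 * E.refresh (m + 1) → s' ≤ 1 →
            -- (α₁) frame conjugacy on the full refresh piece `[jR, (j+1)R]`
            FrameConjugacyAt W M hM c Φ Cα ϱ E m S Um1 Um ((j : ℝ) * E.refresh (m + 1)) (((j : ℝ) + 1) * E.refresh (m + 1)) ∧
            -- (α₂) frame conjugacy on the post-refresh piece `[(j+1)R, s']` (only asked when non-degenerate)
            (((j : ℝ) + 1) * E.refresh (m + 1) < s' →
              FrameConjugacyAt W M hM c Φ Cα ϱ E m S Um1 Um (((j : ℝ) + 1) * E.refresh (m + 1)) s') ∧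
            -- (N1′) / (N1*′) N-conversion of the coarse window map's forward / adjoint loss on the full window `[jR, s']`, SOLENOIDAL data (D27-4 R-a)
            (∀ x : V2, Torus.IsWeaklyDivFree (⇑x : VF) → lossFwd (Um ((j : ℝ) * E.refresh (m + 1)) s') x ≤ CN *
               (∑ k' ∈ Sf, min 1 ((E.a (m + 1) * (8 * Real.pi ^ 2 * ‖Torus.latticeVec k'‖ ^ 2 * lo * (E.cellVisc (m + 1) + c / E.cellVisc (m + 1)) / (E.N (m + 1) : ℝ) ^ 2)) * (s' - (j : ℝ) * E.refresh (m + 1))) * ‖UnitAddTorus.mFourierCoeff (EuclideanSpace.complexify ∘ ⇑(x)) k'‖ ^ 2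
                    + (‖x‖ ^ 2 - ∑ k' ∈ Sf, ‖UnitAddTorus.mFourierCoeff (EuclideanSpace.complexify ∘ ⇑(x)) k'‖ ^ 2))) ∧
            (∀ y : V2, Torus.IsWeaklyDivFree (⇑y : VF) → lossAdj (Um ((j : ℝ) * E.refresh (m + 1)) s') y ≤ CN *
               (∑ k' ∈ Sf, min 1 ((E.a (m + 1) * (8 * Real.pi ^ 2 * ‖Torus.latticeVec k'‖ ^ 2 * lo * (E.cellVisc (m + 1) + c / E.cellVisc (m + 1)) / (E.N (m + 1) : ℝ) ^ 2)) * (s' - (j : ℝ) * E.refresh (m + 1))) * ‖UnitAddTorus.mFourierCoeff (EuclideanSpace.complexify ∘ ⇑(y)) k'‖ ^ 2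
                    + (‖y‖ ^ 2 - ∑ k' ∈ Sf, ‖UnitAddTorus.mFourierCoeff (EuclideanSpace.complexify ∘ ⇑(y)) k'‖ ^ 2))) ∧
            -- (N2) loss-rate monotonicity of the coarse flow across the refresh boundary `r₁ = (j+1)R`
            (∀ x : V2, lossFwd (Um (((j : ℝ) + 1) * E.refresh (m + 1)) s') (Um ((j : ℝ) * E.refresh (m + 1)) (((j : ℝ) + 1) * E.refresh (m + 1)) x)
               ≤ Cmono * ((s' - ((j : ℝ) + 1) * E.refresh (m + 1)) / E.refresh (m + 1))
                 * lossFwd (Um ((j : ℝ) * E.refresh (m + 1)) (((j : ℝ) + 1) * E.refresh (m + 1))) x)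

/-- **The αβ hypothesis, PRE-PROJECTED form (D27-4′) — what the glue `cellInputs_BIL_ofP` CONSUMES.**  `cellInputs_alphaBeta_text` VERBATIM except
that the N-conversions (N1ᴾ)/(N1*ᴾ) bound the losses of the PROJECTED data `P_σ x`, `P_σ y` by the N-currency of `x`, `y`. -/
def cellInputs_alphaBeta_textP : Prop :=
 ∀ k (W : Literature.Analysis.FluidPDE.LatticeShear.LatticeWord k) (M : ℝ) (hM : 0 < M) (c : ℝ), 0 < c →
    ∀ (Φ : ℝ → Torus.Visc4 (Fin 3) → Torus.Visc4 (Fin 3)) (lo hi Λ β σ C ν₀ K Cf νf Kf : ℝ),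
      0 < lo → lo ≤ 1 → 1 ≤ hi → 1 < Λ → 0 ≤ β →
      0 < σ → 0 ≤ C → 0 < ν₀ → 0 < K → SlowVectorClauseF W M hM c Φ lo hi Λ β σ C ν₀ K →
      0 ≤ Cf → 0 < νf → 0 < Kf → CellEnergyClausesW W M hM c lo hi Λ β Cf νf Kf →
      (∀ Kb : ℝ, 1 ≤ Kb → ∃ CK : ℝ, 1 ≤ CK ∧ ∃ cK > (0:ℝ), ∃ νh > (0:ℝ), HighLabelDecayW W M hM lo hi Λ β νh Kb CK cK) →
      ∃ ν₁ > (0:ℝ), ∃ K₁ > (0:ℝ), ∃ Λ₀ : ℕ, ∃ θ₀ > (0:ℝ), ∃ Cα > (0:ℝ), ∃ ϱ > (0:ℝ), ∃ CN > (0:ℝ), ∃ Cmono > (0:ℝ),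
        ∀ E : Literature.Analysis.FluidPDE.LatticeShear.LagrangianLatticeCarrier k, E.design = W.stretch M hM → E.gain = c → E.nu0 ≤ ν₁ → K₁ ≤ E.K →
          E.LPermissible → E.Regular → (∀ m, Λ₀ * E.N m ≤ E.N (m + 1)) → (∀ m, E.N m ^ 2 ≤ E.N (m + 1)) →
          (∀ m, E.cellVisc (m + 1) * ((E.N (m + 1) : ℝ) / E.N m) ^ (1 / 4 : ℝ) ≤ 1) →
          (∀ m, E.K * ((E.N (m + 1) : ℝ) / E.N m) ^ (1 / 4 : ℝ) ≤ ((E.N (m + 1) : ℝ) / E.N m) * E.cellVisc (m + 1)) →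
          (∀ m, E.θ (m + 1) * ((E.N (m + 1) : ℝ) / E.N m) ^ (1 / 16 : ℝ) ≤ θ₀) →
          (∀ m, ((E.N (m + 1) : ℝ) / E.N m) ^ (1 / 16 : ℝ) * E.physPeriod (m + 1) ≤ E.refresh (m + 1)) →
        ∃ mstar : ℕ, ∀ m, mstar ≤ m →
          ∀ Lc : ℕ, Lc = ⌊((E.N m : ℝ) / E.N (m + 1)) ^ (1 / 64 : ℝ) * (E.N (m + 1) * E.cellVisc (m + 1)) / Real.sqrt c⌋₊ →
          ∀ S : Torus.Visc4 (Fin 3), Torus.OddSmall S β → Torus.NearIso S lo hi →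
            Torus.OddSmall (Φ (E.cellVisc (m + 1)) S) β → Torus.NearIso (Φ (E.cellVisc (m + 1)) S) lo hi →
          ∀ Um Um1 : ℝ → ℝ → (V2 →L[ℝ] V2),
            Torus.IsPropagator 1 (E.partialSum m) (E.kbar m • renormStep (Φ (E.cellVisc (m + 1))) (E.gain / E.cellVisc (m + 1) ^ 2) S) Um →
            Torus.IsPropagator 1 (E.partialSum (m + 1)) (E.kbar (m + 1) • S) Um1 →
          ∀ Sf : Finset (Fin 3 → ℤ), Sf = (Torus.freqBall (Lc / 2)).erase 0 →
          ∀ (j : ℕ) (s' : ℝ), (j : ℝ) * E.refresh (m + 1) + E.refresh (m + 1) ≤ s' →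
            s' ≤ (j : ℝ) * E.refresh (m + 1) + 2 * E.refresh (m + 1) → s' ≤ 1 →
            -- (α₁) frame conjugacy on the full refresh piece `[jR, (j+1)R]`
            FrameConjugacyAt W M hM c Φ Cα ϱ E m S Um1 Um ((j : ℝ) * E.refresh (m + 1)) (((j : ℝ) + 1) * E.refresh (m + 1)) ∧
            -- (α₂) frame conjugacy on the post-refresh piece `[(j+1)R, s']` (only asked when non-degenerate)
            (((j : ℝ) + 1) * E.refresh (m + 1) < s' →
              FrameConjugacyAt W M hM c Φ Cα ϱ E m S Um1 Um (((j : ℝ) + 1) * E.refresh (m + 1)) s') ∧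
            -- (N1ᴾ) / (N1*ᴾ) N-conversion of the coarse window map's forward / adjoint loss on the full window `[jR, s']`, PRE-PROJECTED data `P_σ x`, `P_σ y` (D27-4′)
            (∀ x : V2, lossFwd (Um ((j : ℝ) * E.refresh (m + 1)) s') ((Torus.divFreeL2 (Fin 3)).starProjection x) ≤ CN *
               (∑ k' ∈ Sf, min 1 ((E.a (m + 1) * (8 * Real.pi ^ 2 * ‖Torus.latticeVec k'‖ ^ 2 * lo * (E.cellVisc (m + 1) + c / E.cellVisc (m + 1)) / (E.N (m + 1) : ℝ) ^ 2)) * (s' - (j : ℝ) * E.refresh (m + 1))) * ‖UnitAddTorus.mFourierCoeff (EuclideanSpace.complexify ∘ ⇑(x)) k'‖ ^ 2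
                    + (‖x‖ ^ 2 - ∑ k' ∈ Sf, ‖UnitAddTorus.mFourierCoeff (EuclideanSpace.complexify ∘ ⇑(x)) k'‖ ^ 2))) ∧
            (∀ y : V2, lossAdj (Um ((j : ℝ) * E.refresh (m + 1)) s') ((Torus.divFreeL2 (Fin 3)).starProjection y) ≤ CN *
               (∑ k' ∈ Sf, min 1 ((E.a (m + 1) * (8 * Real.pi ^ 2 * ‖Torus.latticeVec k'‖ ^ 2 * lo * (E.cellVisc (m + 1) + c / E.cellVisc (m + 1)) / (E.N (m + 1) : ℝ) ^ 2)) * (s' - (j : ℝ) * E.refresh (m + 1))) * ‖UnitAddTorus.mFourierCoeff (EuclideanSpace.complexify ∘ ⇑(y)) k'‖ ^ 2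
                    + (‖y‖ ^ 2 - ∑ k' ∈ Sf, ‖UnitAddTorus.mFourierCoeff (EuclideanSpace.complexify ∘ ⇑(y)) k'‖ ^ 2))) ∧
            -- (N2) loss-rate monotonicity of the coarse flow across the refresh boundary `r₁ = (j+1)R`
            (∀ x : V2, lossFwd (Um (((j : ℝ) + 1) * E.refresh (m + 1)) s') (Um ((j : ℝ) * E.refresh (m + 1)) (((j : ℝ) + 1) * E.refresh (m + 1)) x)
               ≤ Cmono * ((s' - ((j : ℝ) + 1) * E.refresh (m + 1)) / E.refresh (m + 1))
                 * lossFwd (Um ((j : ℝ) * E.refresh (m + 1)) (((j : ℝ) + 1) * E.refresh (m + 1))) x)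

/-! ## §3 Bridges from the v2 text -/

/-- The v2 text implies the re-cut registered text (drop the guard): `stub_Z7_alphaBeta` (v19–v22) is SUPERSEDED-BY-WEAKER. -/
theorem alphaBeta_textR_of_text (h : cellInputs_alphaBeta_text) : cellInputs_alphaBeta_textR := by
  intro k W M hM c hc Φ lo hi Λ β σ C ν₀ K Cf νf Kf hlo hlo1 hhi hΛ hβ hσ hC hν₀ hK hV hCf hνf hKf hF hH
  obtain ⟨ν₁, hν₁, K₁, hK₁, Λ₀, θ₀, hθ₀, Cα, hCα, ϱ, hϱ, CN, hCN, Cmono, hCmono, hE⟩ :=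
    h k W M hM c hc Φ lo hi Λ β σ C ν₀ K Cf νf Kf hlo hlo1 hhi hΛ hβ hσ hC hν₀ hK hV hCf hνf hKf hF hH
  refine ⟨ν₁, hν₁, K₁, hK₁, Λ₀, θ₀, hθ₀, Cα, hCα, ϱ, hϱ, CN, hCN, Cmono, hCmono, ?_⟩
  intro E hdes hgain hnu0 hKE hLP hReg hT1 hN2 hT2 hT3 hT4 hT5
  obtain ⟨mstar, hm⟩ := hE E hdes hgain hnu0 hKE hLP hReg hT1 hN2 hT2 hT3 hT4 hT5
  refine ⟨mstar, fun m hmm => ?_⟩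
  intro Lc hLc S hSo hSn hΦSo hΦSn Um Um1 hUm hUm1 Sf hSf j s' h1 h2 h3
  obtain ⟨hFC1, hFC2, hN1, hN1s, hN2'⟩ := hm m hmm Lc hLc S hSo hSn hΦSo hΦSn Um Um1 hUm hUm1 Sf hSf j s' h1 h2 h3
  exact ⟨hFC1, hFC2, fun x _ => hN1 x, fun y _ => hN1s y, hN2'⟩

/-- The v2 text implies the pre-projected form (loss monotonicity under `P_σ`): the v22 registry line stays derivable. -/
theorem alphaBeta_textP_of_text (h : cellInputs_alphaBeta_text) : cellInputs_alphaBeta_textP := by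
  intro k W M hM c hc Φ lo hi Λ β σ C ν₀ K Cf νf Kf hlo hlo1 hhi hΛ hβ hσ hC hν₀ hK hV hCf hνf hKf hF hH
  obtain ⟨ν₁, hν₁, K₁, hK₁, Λ₀, θ₀, hθ₀, Cα, hCα, ϱ, hϱ, CN, hCN, Cmono, hCmono, hE⟩ :=
    h k W M hM c hc Φ lo hi Λ β σ C ν₀ K Cf νf Kf hlo hlo1 hhi hΛ hβ hσ hC hν₀ hK hV hCf hνf hKf hF hH
  refine ⟨ν₁, hν₁, K₁, hK₁, Λ₀, θ₀, hθ₀, Cα, hCα, ϱ, hϱ, CN, hCN, Cmono, hCmono, ?_⟩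
  intro E hdes hgain hnu0 hKE hLP hReg hT1 hN2 hT2 hT3 hT4 hT5
  obtain ⟨mstar, hm⟩ := hE E hdes hgain hnu0 hKE hLP hReg hT1 hN2 hT2 hT3 hT4 hT5
  refine ⟨mstar, fun m hmm => ?_⟩
  intro Lc hLc S hSo hSn hΦSo hΦSn Um Um1 hUm hUm1 Sf hSf j s' h1 h2 h3
  obtain ⟨hFC1, hFC2, hN1, hN1s, hN2'⟩ := hm m hmm Lc hLc S hSo hSn hΦSo hΦSn Um Um1 hUm hUm1 Sf hSf j s' h1 h2 h3
  exact ⟨hFC1, hFC2, fun x => (lossFwd_starProjection_le hUm _ _ x).trans (hN1 x),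
    fun y => (lossAdj_starProjection_le hUm _ _ y).trans (hN1s y), hN2'⟩

end Summit.AnomalousDissipation.AnomalousDissipation.Theorems.SolenoidalFractalHomogenisation.LagrangianStep.Z7Glue

end
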